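import Literature.IUT.LogVolume.UnitLogMaxNorm
import Literature.IUT.LogVolume.UnitLogValuationSpectrum
import Literature.IUT.LogVolume.LogUnitsRootTwist
import Literature.IUT.LogVolume.LogShellTopology
import HarnessLib

/-!
# D-0079 RESCUE sub-cell R-H, ROUND 1 (D-0107), row 20 `linear-reach-law` — `RHLinearReachLaw` (1/2): the author's candidate vocabulary
# (abc-iut-lens-control-1) FILED FOR THE TREE, its integer column currency, and the two lattice integers of `log_p(𝒪_K^×)` CERTIFIED

[R-H candidate — a HYPOTHESIS, claim-tagged `def … : Prop`; never a Literature fact; typed ≠ proved; instantiated ≠ endorsed.] Seat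
abc-iut-rh-typ-7 gen 2 (TYPER of pair 7 → row 20 after row 7; tester abc-iut-rh-tst-7; lead abc-iut-rh-lead g0; k1 pen of record
abc-iut-rh-num-1). TAKES NO SIDE on [IUTchIII] Cor. 3.12 or on any author; nothing here asserts abc proved or refuted. Companion file (2/2):
`Repair/RHLinearReachLawGenuine.lean` — the deciding declaration `RH.LinearReachLaw.HStar X` over a pilot datum / `Cor312Prov.pilotDataOfK D K`.

ROW 20 OF `plan/rescue/R-H/RH-CANDIDATES.tsv` (v1.5 b91c1bf8b2319f98, one writer abc-iut-rh-lead g0), informal statement VERBATIM: «LINEAR REACH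
LAW: for all bad w|p (unique over p), all j <= l*: (j^2−1)·m_w + e_w <= (j+1)·D_w, D_w = (e_w − 1) + (c_w − B_w); c_w = inner conductor, B_w =
outer order of log_p(O_w^x); m_w = e_w·H/(2l) — the LINEAR ENVELOPE (in the label) with INNER-CONDUCTOR credit of the hull-reach family»;
k1 recipe «m_w := e_w·H/(2l); c_w := col 31 r_in_ub; B_w := col 32 r_out_sharp; CELL := [(j^2−1)·m_w + e_w <= (j+1)·((e_w−1) + (c_w − B_w))]».
Author's bytes: `HOME/staging/RH/abc-iut-lens-control-1/HStar-linear-reach-law.lean` sha16 31a67430082d044a (187 l, rc 0) — §A reproduces its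
declarations with BYTE-IDENTICAL signatures (`inflation`, `ReachCell`, `LinearLaw`, `reachCell_of_linearLaw`, `linear_of_reachCell`,
`linearLaw_mono_depth`, `IsInnerConductor`, `IsOuterOrder`, `HStarLinearReachLaw`, `HReachCell`, `hReachCell_of_hStar`; docstrings verbatim up
to provenance tags), so that the k2 hand cites ONE tree name. §T1–§T2 are this seat's typer block:
* §T1 integer currency: `phi` / `linearLaw_iff_phi_nonneg` (cell ⟺ slack `Φ ≥ 0`); `LinearLaw2l` (the `2l`-cleared law in the datum's own
  integers `ord_x(q) = 2l·m_w`) with `linearLaw2l_iff`; MONOTONICITY IN THE CERTIFICATES `linearLaw(2l)_mono_cert` (a larger inner conductor / a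
  smaller outer order only help); CONCAVITY IN THE LABEL `linearLaw_of_endpoints` and `linearLaw_of_top` (`e ≥ 2`, `B ≤ c`, `m ≥ 0`: the top label
  binds — the datum verdict at a place is its `j = l⋆` cell; the law is NOT monotone in `j` in general); `not_linearLaw_one_one_one` (`e = c = B = 1`,
  the unramified odd place: NEG at every label).
* §T2 THE TWO LATTICE INTEGERS, for EVERY proper ultrametric `ℚ_p`-field `K` and norm uniformizer `ϖ`: uniqueness (`isInnerConductor_unique`,
  `isOuterOrder_unique`), existence (`exists_isInnerConductor`; `exists_isOuterOrder` by compactness of `log_p(𝒪^×)`, [IUTchIII] Def. 1.1 (i)),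
  the CERTIFIED COLUMN BOUNDS `c ≤ ⌊e/(p−1)⌋ + 1 = r_in_ub` (`isInnerConductor_le`, S-lane `LogEnvelope.closedBall_div_succ_subset_logUnits`) and
  `B ≥ p^{a₀} − e·a₀ = r_out_sharp` at any turning point (`le_of_isOuterOrder`, c312-3 `LogEnvelope.forall_mem_logUnits_norm_le_envelope`),
  EXACTNESS OFF THE TIES `(p−1) ∤ e ⇒ c = r_in_ub` (`isInnerConductor_of_not_dvd`, `LogEnvelope.closedBall_pow_subset_logUnits_iff`) and
  `e < p^{a₀}(p−1) ⇒ B = r_out_sharp` (`isOuterOrder_envelope`, `LogEnvelope.isGreatest_norm_logUnits`); hence the SEMANTIC DECIDERS of the author's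
  cell `hStarLinearReachLaw_iff_of_certs` / `hStarLinearReachLaw_iff_col` and the UNCONDITIONAL NECESSITY of the column reading
  `linearLaw_col_of_hStarLinearReachLaw` (a column-NEG cell is a certified NEG of H⋆ at every field of that type, ties included).
[cite: Mochizuki2012, IUTchI Ex. 3.2 (iv) p. 71; IUTchIII Def. 1.1 (i) p. 24, Thm. 3.11 (i) (Ind2) p. 154; IUTchIV Prop. 1.2 (i) p. 10]
[cite: NeukirchANT1999, Ch. II (5.5)] [claim: Mochizuki2012, status: disputed] for every IUT sentence quoted. 0 sorry; standard axioms.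
-/

noncomputable section

open Set Metric Function

namespace Summit.ABC.IUTFork.Repair.RH.LinearReachLaw

open Metric Set Literature.IUT.LogVolume Literature.NumberTheory.GaloisRepresentations.Ultrametric

/-! ## §A. The author's vocabulary and candidate (abc-iut-lens-control-1, `HStar-linear-reach-law.lean` 31a67430082d044a, verbatim) -/

/-! ### §A.1 Integer layer — the k1 recipe (columns `e_w`, `H`, `l`, `j`, `r_in_ub`, `r_out_sharp`) -/

/-- **Per-factor (Ind2)-inflation** `D = (e − 1) + (c − B)`: tame part `e − 1` plus the spectral width
`c − B` of the unit-log lattice. [R-H candidate, hypothesis — not a fact] [claim: Mochizuki2012, status: disputed] -/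
def inflation (e c B : ℤ) : ℤ := (e - 1) + (c - B)

/-- **One-place reach cell** at label `j`, `q`-depth `m`: some integer content `k` of a pure
`(j+1)`-tensor of maximal-order primitive vectors fits the Θ-box of depth `j²·m` (first conjunct) and its
`Ism^{DH}`-reach `e·k + (j+1)·B` dominates `t_q` (second conjunct).
[R-H candidate, hypothesis — not a fact] [claim: Mochizuki2012, status: disputed] -/
def ReachCell (e c B : ℤ) (j : ℕ) (m : ℤ) : Prop :=
  ∃ k : ℤ, (j : ℤ) ^ 2 * m ≤ e * k + ((j : ℤ) + 1) * (c + e - 1) ∧ e * k + ((j : ℤ) + 1) * B ≤ m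

/-- **The candidate's integer core — the LINEAR REACH LAW** `(j² − 1)·m + e ≤ (j+1)·D`, i.e.
`(j − 1)·m + e/(j+1) ≤ D = (e − 1) + (c − B)`. [R-H candidate, hypothesis — not a fact]
[claim: Mochizuki2012, status: disputed] -/
def LinearLaw (e c B : ℤ) (j : ℕ) (m : ℤ) : Prop :=
  ((j : ℤ) ^ 2 - 1) * m + e ≤ ((j : ℤ) + 1) * inflation e c B

/-- `LinearLaw → ReachCell` (take the content `k = ⌈(j²m − (j+1)(c+e−1))/e⌉`). Pure integer arithmetic.
[R-H candidate, hypothesis — not a fact] [folklore] -/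
theorem reachCell_of_linearLaw {e c B : ℤ} {j : ℕ} {m : ℤ} (he : 0 < e) (h : LinearLaw e c B j m) :
    ReachCell e c B j m := by
  unfold LinearLaw inflation at h
  set X : ℤ := (j : ℤ) ^ 2 * m - ((j : ℤ) + 1) * (c + e - 1) with hX
  refine ⟨(X + e - 1) / e, ?_, ?_⟩
  · have h0 := Int.emod_nonneg (X + e - 1) he.ne'
    have h1 := Int.emod_lt_of_pos (X + e - 1) he
    have h2 := Int.mul_ediv_add_emod (X + e - 1) e
    have hid : ((j : ℤ) + 1) * (c + e - 1) = (j : ℤ) ^ 2 * m - X := by rw [hX]; ring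
    rw [hid]
    linarith
  · have h0 := Int.emod_nonneg (X + e - 1) he.ne'
    have h2 := Int.mul_ediv_add_emod (X + e - 1) e
    have hid : X + e - 1 + ((j : ℤ) + 1) * B =
        (j : ℤ) ^ 2 * m + e - 1 - ((j : ℤ) + 1) * ((e - 1) + (c - B)) := by rw [hX]; ring
    linarith

/-- `ReachCell → (j² − 1)·m ≤ (j+1)·D` (the necessary linear edge; the two edges differ by `< e`, i.e. by
less than one `p`-adic unit of depth). [R-H candidate, hypothesis — not a fact] [folklore] -/
theorem linear_of_reachCell {e c B : ℤ} {j : ℕ} {m : ℤ} (h : ReachCell e c B j m) :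
    ((j : ℤ) ^ 2 - 1) * m ≤ ((j : ℤ) + 1) * inflation e c B := by
  obtain ⟨k, h1, h2⟩ := h
  unfold inflation
  have hid : ((j : ℤ) + 1) * ((e - 1) + (c - B)) = ((j : ℤ) + 1) * (c + e - 1) - ((j : ℤ) + 1) * B := by
    ring
  rw [hid]
  linarith

/-- `LinearLaw` is monotone in the depth: a shallower `q` at the same place and label still satisfies it
(`j ≥ 1`). [R-H candidate, hypothesis — not a fact] [folklore] -/
theorem linearLaw_mono_depth {e c B : ℤ} {j : ℕ} {m m' : ℤ} (hj : 1 ≤ j) (hm : m' ≤ m)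
    (h : LinearLaw e c B j m) : LinearLaw e c B j m' := by
  unfold LinearLaw at h ⊢
  have hj' : (0 : ℤ) ≤ (j : ℤ) ^ 2 - 1 := by
    have : (1 : ℤ) ≤ (j : ℤ) := by exact_mod_cast hj
    nlinarith
  nlinarith

/-! #### k4 witness cells (table I06STAR-COLUMNS v2.1, family HEX, local type `ev1` over 7, `l = 11`,
top label `j = l⋆ = 5`, `e_w = 11`, `c_w = r_in_ub = 2`, `B_w = r_out_sharp = −4`, `m_w = e_w·H/(2l) = H/2`) -/

/-- HEX:2:11@p7.j5.ev1 (`H = 4`, `m_w = 2`): the linear law HOLDS (`59 ≤ 96`) — while I06⋆ is NEG there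
by `Repair.CandInternal2RealStrata.not_mem_pow_smul_logShell_of_root_lt` (table col. `deciding_decl`). -/
example : LinearLaw 11 2 (-4) 5 2 := by norm_num [LinearLaw, inflation]

/-- … and so does the exact reach cell there (content `k = −2`). -/
example : ReachCell 11 2 (-4) 5 2 := ⟨-2, by norm_num, by norm_num⟩

/-- HEX:8:11@p7.j5.ev1 (`H = 16`, `m_w = 8`): the linear law FAILS (`203 ≤ 96` is false) — the
candidate is not vacuous / not Statement-strength-by-triviality on the row set. -/
example : ¬ LinearLaw 11 2 (-4) 5 8 := by norm_num [LinearLaw, inflation]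

/-! ### §A.2 Semantic layer — the two integers read off `log_p(𝒪_K^×)` and the H⋆ cell -/

section Field

variable (p : ℕ) [Fact p.Prime]
variable (K : Type*) [NontriviallyNormedField K] [NormedAlgebra ℚ_[p] K] [IsUltrametricDist K]
  [ProperSpace K]

/-- **Inner conductor** of the unit-log lattice w.r.t. the norm uniformizer `ϖ`: `c` is the LEAST natural
exponent with `{‖z‖ ≤ ‖ϖ‖^c} ⊆ log_p(𝒪_K^×)` (such exponents exist by
`closedBall_subset_logUnits_of_mul_rpow_lt_one`: every `c > e/(p−1)` qualifies — note `log_p(𝒪_K^×)`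
carries no `p`-argument in the tree (`unitLog` is intrinsic), so neither does this predicate; classically
`c = ⌊e/(p−1)⌋ + 1` unless `(p−1) ∣ e`). [R-H candidate, hypothesis — not a fact]
[claim: Mochizuki2012, status: disputed] -/
def IsInnerConductor (ϖ : Kˣ) (c : ℕ) : Prop :=
  closedBall (0 : K) (‖(ϖ : K)‖ ^ c) ⊆ logUnits K ∧
    ∀ c' : ℕ, closedBall (0 : K) (‖(ϖ : K)‖ ^ c') ⊆ logUnits K → c ≤ c'

/-- **Outer order** of the unit-log lattice: `max ‖log_p(𝒪_K^×)‖ = ‖ϖ‖^B` (attained; `B = p^{a₀} − e·a₀`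
off the cyclotomic indices by `LogEnvelope.isGreatest_norm_logUnits`; `B ≤ 1`, and `B < 0` at deep places).
[R-H candidate, hypothesis — not a fact] [claim: Mochizuki2012, status: disputed] -/
def IsOuterOrder (ϖ : Kˣ) (B : ℤ) : Prop :=
  (∀ z ∈ logUnits K, ‖z‖ ≤ ‖(ϖ : K)‖ ^ B) ∧ ∃ z ∈ logUnits K, ‖z‖ = ‖(ϖ : K)‖ ^ B

/-- **H⋆ = `HStarLinearReachLaw`** — the R-H candidate of seat abc-iut-lens-control-1 (lens `control`),
ONE CELL: at the bad place with completion `K` (norm uniformizer `ϖ`), label `j` (`1 ≤ j ≤ l⋆`) and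
`q`-depth `m = ord_ϖ(q̲_w) = e·H/(2l)`, the LINEAR REACH LAW holds for the inner conductor and outer order
of `log_p(𝒪_K^×)`:  `(j² − 1)·m + e ≤ (j+1)·((e − 1) + (c − B))`.  A DATUM satisfies H⋆ iff all its cells
at bad places over primes with a unique place do (binding cell = top label, `linearLaw_mono_depth` and
monotonicity in `j`).  This REPLACES the crux's quadratic one-shell demand `(j² − 1)·m ≤ d`; it is NOT
I06⋆, NOT the Statement, NOT a Literature fact, and is offered for k1–k4 testing only.
[R-H candidate, hypothesis — not a fact] [claim: Mochizuki2012, status: disputed] -/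
def HStarLinearReachLaw (ϖ : Kˣ) (j : ℕ) (m : ℤ) : Prop :=
  ∀ (c : ℕ) (B : ℤ), IsInnerConductor K ϖ c → IsOuterOrder K ϖ B →
    LinearLaw (absRamificationIdx p K : ℤ) (c : ℤ) B j m

/-- The exact (non-linearised) companion cell, for the k2 hand: H⋆ implies it factor-free
(`reachCell_of_linearLaw`, `absRamificationIdx_pos`). [R-H candidate, hypothesis — not a fact]
[claim: Mochizuki2012, status: disputed] -/
def HReachCell (ϖ : Kˣ) (j : ℕ) (m : ℤ) : Prop :=
  ∀ (c : ℕ) (B : ℤ), IsInnerConductor K ϖ c → IsOuterOrder K ϖ B →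
    ReachCell (absRamificationIdx p K : ℤ) (c : ℤ) B j m

/-- `HStarLinearReachLaw → HReachCell`. [R-H candidate, hypothesis — not a fact] [folklore] -/
theorem hReachCell_of_hStar {ϖ : Kˣ} {j : ℕ} {m : ℤ} (h : HStarLinearReachLaw p K ϖ j m) :
    HReachCell p K ϖ j m :=
  fun c B hc hB => reachCell_of_linearLaw (by exact_mod_cast absRamificationIdx_pos p K) (h c B hc hB)

end Field

/-! ## §T1. (typer) The law in the INTEGER COLUMN CURRENCY of I06STAR-COLUMNS: slack, `2l`-cleared form, monotonicity, concavity -/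

/-- **Cell slack `Φ = (j+1)·D − (j²−1)·m − e`** (the author's controlling quantity at the top label: `Φ_w = (l⋆+1)·D_w − (l⋆²−1)·m_w − e_w`):
the integer whose sign is the k1 cell. Candidate vocabulary, asserts nothing. [claim: Mochizuki2012, status: disputed] -/
def phi (e c B : ℤ) (j : ℕ) (m : ℤ) : ℤ := ((j : ℤ) + 1) * inflation e c B - (((j : ℤ) ^ 2 - 1) * m + e)

/-- `LinearLaw ⟺ 0 ≤ Φ`. [folklore] -/
theorem linearLaw_iff_phi_nonneg (e c B : ℤ) (j : ℕ) (m : ℤ) : LinearLaw e c B j m ↔ 0 ≤ phi e c B j m := by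
  unfold LinearLaw phi
  constructor
  · intro h; linarith
  · intro h; linarith

/-- **The `2l`-cleared law** in the datum's own integers: `(j²−1)·ord_x(q) + 2l·e ≤ 2l·(j+1)·D` with `ord_x(q) = 2l·m_w` (`H = ord_x(q)/e_x`,
`m_w = e_w·H/(2l)`). This is the cell the deciding declaration `CellAt` carries (no divisibility assumption on `ord_x(q)`); at realising data it
is `LinearLaw` (`linearLaw2l_iff`). Candidate vocabulary, asserts nothing. [claim: Mochizuki2012, status: disputed] -/
def LinearLaw2l (e c B : ℤ) (j : ℕ) (ordq : ℤ) (l : ℕ) : Prop :=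
  ((j : ℤ) ^ 2 - 1) * ordq + 2 * l * e ≤ 2 * l * (((j : ℤ) + 1) * inflation e c B)

/-- `ord_x(q) = 2l·m` ⇒ (`LinearLaw2l ⟺ LinearLaw`). [folklore] -/
theorem linearLaw2l_iff {e c B : ℤ} {j : ℕ} {ordq m : ℤ} {l : ℕ} (hl : 0 < l) (h : ordq = 2 * l * m) :
    LinearLaw2l e c B j ordq l ↔ LinearLaw e c B j m := by
  subst h
  unfold LinearLaw2l LinearLaw
  have hl' : (0 : ℤ) < 2 * l := by positivity
  constructor
  · intro h'; nlinarith
  · intro h'; nlinarith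

/-- **Monotonicity in the certificates**: a larger inner conductor and a smaller outer order only HELP the law. (So certified bounds
`c ≤ c♯`, `B♯ ≤ B` turn the column cell at `(c♯, B♯)` into a NECESSARY condition.) [folklore] -/
theorem linearLaw_mono_cert {e c c' B B' : ℤ} {j : ℕ} {m : ℤ} (hc : c ≤ c') (hB : B' ≤ B) (h : LinearLaw e c B j m) :
    LinearLaw e c' B' j m := by
  unfold LinearLaw inflation at h ⊢
  have hj : (0 : ℤ) ≤ (j : ℤ) + 1 := by positivity
  nlinarith [mul_le_mul_of_nonneg_left (show (e - 1) + (c - B) ≤ (e - 1) + (c' - B') by linarith) hj]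

/-- The same monotonicity for the `2l`-cleared law. [folklore] -/
theorem linearLaw2l_mono_cert {e c c' B B' : ℤ} {j : ℕ} {ordq : ℤ} {l : ℕ} (hc : c ≤ c') (hB : B' ≤ B)
    (h : LinearLaw2l e c B j ordq l) : LinearLaw2l e c' B' j ordq l := by
  unfold LinearLaw2l inflation at h ⊢
  have hj : (0 : ℤ) ≤ 2 * l * ((j : ℤ) + 1) := by positivity
  nlinarith [mul_le_mul_of_nonneg_left (show (e - 1) + (c - B) ≤ (e - 1) + (c' - B') by linarith) hj]

/-- **Concavity in the label**: for `m ≥ 0` the slack `Φ(j)` is concave in `j`, so on `1 ≤ j ≤ J` the law follows from the two ENDPOINT cells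
`j = 1` and `j = J`. (The law is NOT monotone in `j` in general: `Φ(j+1) − Φ(j) = D − (2j+1)·m` changes sign.) [folklore] -/
theorem linearLaw_of_endpoints {e c B : ℤ} {j J : ℕ} {m : ℤ} (hm : 0 ≤ m) (h1j : 1 ≤ j) (hjJ : j ≤ J)
    (h1 : LinearLaw e c B 1 m) (hJ : LinearLaw e c B J m) : LinearLaw e c B j m := by
  unfold LinearLaw at h1 hJ ⊢
  have hj1 : (1 : ℤ) ≤ (j : ℤ) := by exact_mod_cast h1j
  have hjJ' : (j : ℤ) ≤ (J : ℤ) := by exact_mod_cast hjJ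
  push_cast at h1
  by_cases hcase : ((j : ℤ) + 1) * m ≤ inflation e c B
  · nlinarith [mul_nonneg (sub_nonneg.2 hj1) (sub_nonneg.2 hcase)]
  · rw [not_le] at hcase
    have hJ1 : (0 : ℤ) ≤ ((J : ℤ) - 1) * m := mul_nonneg (by linarith) hm
    nlinarith [mul_nonneg (sub_nonneg.2 hjJ') (show (0 : ℤ) ≤ ((J : ℤ) + j) * m - inflation e c B by nlinarith)]

/-- **The cell at `j = 1` holds whenever `e ≥ 2` and `B ≤ c`** (`e ≤ 2(e−1) + 2(c−B)`); `B ≤ 1 ≤ c` always holds for the two lattice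
integers (`B ≤ 1`: `log_p(1+ϖ^e…)`; `c ≥ 1`), so only `e = 1` can fail at the bottom label. [folklore] -/
theorem linearLaw_one_of_two_le {e c B : ℤ} (he : 2 ≤ e) (hBc : B ≤ c) (m : ℤ) : LinearLaw e c B 1 m := by
  unfold LinearLaw inflation
  push_cast
  nlinarith

/-- **THE TOP LABEL BINDS** (`e ≥ 2`, `B ≤ c`, `m ≥ 0`): the cell at `J` implies the cell at every `1 ≤ j ≤ J` — so a datum's verdict at a
place is its `j = l⋆` cell, as the k1 recipe of the hull-reach family reads it. [folklore] -/
theorem linearLaw_of_top {e c B : ℤ} {j J : ℕ} {m : ℤ} (he : 2 ≤ e) (hBc : B ≤ c) (hm : 0 ≤ m) (h1j : 1 ≤ j) (hjJ : j ≤ J)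
    (hJ : LinearLaw e c B J m) : LinearLaw e c B j m :=
  linearLaw_of_endpoints hm h1j hjJ (linearLaw_one_of_two_le he hBc m) hJ

/-- **`e = c = B = 1` (the UNRAMIFIED ODD place: `⌊1/(p−1)⌋ + 1 = 1`, turning point `0`): the law FAILS at every label `j ≥ 1`, `m ≥ 0`**
(`(j²−1)·m + 1 ≤ 0` is false). H⋆₂₀ demands nothing it could be refuted on there: it is simply NEG (cf. the unramified-odd refutation
family of I06⋆, `Repair.CandInternal2Real.not_mem_jsq_smul_logShell_of_unramified`). [folklore] -/
theorem not_linearLaw_one_one_one {j : ℕ} {m : ℤ} (hm : 0 ≤ m) (hj : 1 ≤ j) : ¬ LinearLaw 1 1 1 j m := by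
  unfold LinearLaw inflation
  have hj1 : (1 : ℤ) ≤ (j : ℤ) := by exact_mod_cast hj
  have : (0 : ℤ) ≤ ((j : ℤ) ^ 2 - 1) * m := mul_nonneg (by nlinarith) hm
  intro h
  linarith

/-! ## §T2. (typer) The two lattice integers: well-defined, column-certified, exact off the ties; semantic deciders of the author's cell -/

section Lattice

variable (p : ℕ) [hp : Fact p.Prime]
variable {K : Type*} [NontriviallyNormedField K] [instK : NormedAlgebra ℚ_[p] K] [IsUltrametricDist K] [ProperSpace K]

omit hp instK [IsUltrametricDist K] [ProperSpace K] in
/-- The inner conductor is UNIQUE (it is a least element). [folklore] -/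
theorem isInnerConductor_unique {ϖ : Kˣ} {c c' : ℕ} (h : IsInnerConductor K ϖ c) (h' : IsInnerConductor K ϖ c') : c = c' :=
  le_antisymm (h.2 c' h'.1) (h'.2 c h.1)

omit hp instK [IsUltrametricDist K] [ProperSpace K] in
/-- The outer order is UNIQUE (`B ↦ ‖ϖ‖^B` is injective for a uniformizer). [folklore] -/
theorem isOuterOrder_unique {ϖ : Kˣ} (hϖ : IsUniformizer ϖ) {B B' : ℤ} (h : IsOuterOrder K ϖ B) (h' : IsOuterOrder K ϖ B') :
    B = B' := by
  obtain ⟨z, hz, hzB⟩ := h.2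
  obtain ⟨z', hz', hzB'⟩ := h'.2
  have h1 := h'.1 z hz
  have h2 := h.1 z' hz'
  rw [hzB] at h1
  rw [hzB'] at h2
  exact zpow_right_injective₀ (norm_units_pos ϖ) hϖ.1.ne (le_antisymm h1 h2)

omit hp instK [IsUltrametricDist K] [ProperSpace K] in
/-- The two predicates depend on `ϖ` only through `‖ϖ‖` (inner conductor). [folklore] -/
theorem isInnerConductor_congr {ϖ ϖ' : Kˣ} (h : ‖(ϖ : K)‖ = ‖(ϖ' : K)‖) (c : ℕ) :
    IsInnerConductor K ϖ c ↔ IsInnerConductor K ϖ' c := by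
  unfold IsInnerConductor; rw [h]

omit hp instK [IsUltrametricDist K] [ProperSpace K] in
/-- The two predicates depend on `ϖ` only through `‖ϖ‖` (outer order). [folklore] -/
theorem isOuterOrder_congr {ϖ ϖ' : Kˣ} (h : ‖(ϖ : K)‖ = ‖(ϖ' : K)‖) (B : ℤ) :
    IsOuterOrder K ϖ B ↔ IsOuterOrder K ϖ' B := by
  unfold IsOuterOrder; rw [h]

/-- **`c ≤ ⌊e/(p−1)⌋ + 1 = r_in_ub` (column 31), for EVERY `p` and `e`**: the ball of that exponent lies in `log_p(𝒪_K^×)`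
(`LogEnvelope.closedBall_div_succ_subset_logUnits`, Neukirch II (5.5)). [cite: NeukirchANT1999, Ch. II (5.5)] -/
theorem isInnerConductor_le {ϖ : Kˣ} (hϖ : IsUniformizer ϖ) {c : ℕ} (h : IsInnerConductor K ϖ c) :
    c ≤ absRamificationIdx p K / (p - 1) + 1 :=
  h.2 _ (LogEnvelope.closedBall_div_succ_subset_logUnits p hϖ)

include hp instK in
/-- **The inner conductor EXISTS** (the least exponent whose ball lies in `log_p(𝒪_K^×)`; `⌊e/(p−1)⌋ + 1` qualifies; stated for the
`ℚ_p`-algebra structure carried by `K`, which supplies the witness). [cite: NeukirchANT1999, Ch. II (5.5)] -/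
theorem exists_isInnerConductor {ϖ : Kˣ} (hϖ : IsUniformizer ϖ) : ∃ c : ℕ, IsInnerConductor K ϖ c := by
  classical
  have hex : ∃ n : ℕ, closedBall (0 : K) (‖(ϖ : K)‖ ^ n) ⊆ logUnits K :=
    ⟨_, LogEnvelope.closedBall_div_succ_subset_logUnits p hϖ⟩
  exact ⟨Nat.find hex, Nat.find_spec hex, fun c' hc' => Nat.find_min' hex hc'⟩

/-- **`(p−1) ∤ e` ⇒ the inner conductor IS `⌊e/(p−1)⌋ + 1 = r_in_ub`** (abc-iut S-lane `LogEnvelope.closedBall_pow_subset_logUnits_iff`: the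
element `ϖ^{⌊e/(p−1)⌋}` is not a unit logarithm). [cite: NeukirchANT1999, Ch. II (5.5)] -/
theorem isInnerConductor_of_not_dvd {ϖ : Kˣ} (hϖ : IsUniformizer ϖ) (hnd : ¬ (p - 1 ∣ absRamificationIdx p K)) :
    IsInnerConductor K ϖ (absRamificationIdx p K / (p - 1) + 1) :=
  ⟨LogEnvelope.closedBall_div_succ_subset_logUnits p hϖ,
    fun c' hc' => (LogEnvelope.closedBall_pow_subset_logUnits_iff p hϖ hnd c').1 hc'⟩

include hp instK in
/-- **The outer order EXISTS**: `log_p(𝒪_K^×)` is compact ([IUTchIII] Def. 1.1 (i); `isCompact_logUnits`) and contains the nonzero element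
`ϖ^{⌊e/(p−1)⌋+1}`, so `‖·‖` attains a positive maximum on it, at an element whose norm is a power of `‖ϖ‖`. [cite: NeukirchANT1999, Ch. II (5.5)] -/
theorem exists_isOuterOrder {ϖ : Kˣ} (hϖ : IsUniformizer ϖ) : ∃ B : ℤ, IsOuterOrder K ϖ B := by
  have hne : (logUnits K).Nonempty := ⟨_, unitLog_mem_logUnits (u := (1 : K)) norm_one⟩
  obtain ⟨z₀, hz₀, hmax⟩ := (isCompact_logUnits p K).exists_isMaxOn hne continuous_norm.continuousOn
  rw [isMaxOn_iff] at hmax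
  have hmem : (ϖ : K) ^ (absRamificationIdx p K / (p - 1) + 1) ∈ logUnits K :=
    LogEnvelope.closedBall_div_succ_subset_logUnits p hϖ (mem_closedBall_zero_iff.2 (norm_pow _ _).le)
  have hpos : 0 < ‖z₀‖ := by
    have h1 := hmax _ hmem
    have h2 : 0 < ‖(ϖ : K) ^ (absRamificationIdx p K / (p - 1) + 1)‖ := by
      rw [norm_pow]; exact pow_pos (norm_units_pos ϖ) _
    linarith
  have hz0 : z₀ ≠ 0 := norm_pos_iff.1 hpos
  obtain ⟨k, hk⟩ := hϖ.2 (Units.mk0 z₀ hz0)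
  rw [Units.val_mk0] at hk
  exact ⟨k, fun z hz => hk ▸ hmax z hz, z₀, hz₀, hk⟩

/-- **`B ≥ p^{a₀} − e·a₀ = r_out_sharp` (column 32) at ANY turning point `a₀` of `e`, for EVERY `p` and `e`** (ties included: the envelope bound
`‖log_p u‖ ≤ ‖ϖ‖^{p^{a₀} − e·a₀}` is unconditional, c312-3 `LogEnvelope.forall_mem_logUnits_norm_le_envelope`). [cite: NeukirchANT1999, Ch. II (5.5)] -/
theorem le_of_isOuterOrder {ϖ : Kˣ} (hϖ : IsUniformizer ϖ) {B : ℤ} (h : IsOuterOrder K ϖ B) {a₀ : ℕ}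
    (hlo : ∀ a < a₀, (p : ℤ) ^ a * ((p : ℤ) - 1) < absRamificationIdx p K)
    (hhi : (absRamificationIdx p K : ℤ) ≤ (p : ℤ) ^ a₀ * ((p : ℤ) - 1)) :
    (p : ℤ) ^ a₀ - (absRamificationIdx p K : ℤ) * (a₀ : ℤ) ≤ B := by
  obtain ⟨z, hz, hzB⟩ := h.2
  have h1 := LogEnvelope.forall_mem_logUnits_norm_le_envelope p hϖ hlo hhi z hz
  rw [hzB] at h1
  exact (zpow_le_zpow_iff_right_of_lt_one₀ (norm_units_pos ϖ) hϖ.1).1 h1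

/-- **`e < p^{a₀}·(p−1)` (untied turning point) ⇒ the outer order IS `p^{a₀} − e·a₀ = r_out_sharp`**: attained by `log_p(1 + ϖ)`
(c312-3 `LogEnvelope.isGreatest_norm_logUnits`). [cite: NeukirchANT1999, Ch. II (5.5)] -/
theorem isOuterOrder_envelope {ϖ : Kˣ} (hϖ : IsUniformizer ϖ) {a₀ : ℕ}
    (hlo : ∀ a < a₀, (p : ℤ) ^ a * ((p : ℤ) - 1) < absRamificationIdx p K)
    (hhi : (absRamificationIdx p K : ℤ) < (p : ℤ) ^ a₀ * ((p : ℤ) - 1)) :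
    IsOuterOrder K ϖ ((p : ℤ) ^ a₀ - (absRamificationIdx p K : ℤ) * (a₀ : ℤ)) :=
  ⟨LogEnvelope.forall_mem_logUnits_norm_le_envelope p hϖ hlo hhi.le,
    LogEnvelope.exists_mem_logUnits_norm_eq_envelope p hϖ hlo hhi⟩

/-- **SEMANTIC DECIDER of the author's cell**: once the two integers are certified (`IsInnerConductor c₀`, `IsOuterOrder B₀`), H⋆'s cell IS the
integer cell `LinearLaw e c₀ B₀ j m`. [folklore] -/
theorem hStarLinearReachLaw_iff_of_certs {ϖ : Kˣ} (hϖ : IsUniformizer ϖ) {c₀ : ℕ} {B₀ : ℤ} (hc : IsInnerConductor K ϖ c₀)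
    (hB : IsOuterOrder K ϖ B₀) (j : ℕ) (m : ℤ) :
    HStarLinearReachLaw p K ϖ j m ↔ LinearLaw (absRamificationIdx p K : ℤ) (c₀ : ℤ) B₀ j m := by
  constructor
  · intro h; exact h c₀ B₀ hc hB
  · intro h c B hc' hB'
    rw [isInnerConductor_unique hc' hc, isOuterOrder_unique hϖ hB' hB]
    exact h

/-- **THE COLUMN READING IS NECESSARY, UNCONDITIONALLY** (every `p`, every `e`, ties included): H⋆'s cell at `(K, ϖ, j, m)` implies the integer
cell at the column values `c := ⌊e/(p−1)⌋ + 1 = r_in_ub`, `B := p^{a₀} − e·a₀ = r_out_sharp` (any turning point `a₀`). Contrapositive: a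
column-NEG cell is a certified NEG of H⋆ at EVERY field of that type. [cite: NeukirchANT1999, Ch. II (5.5)] -/
theorem linearLaw_col_of_hStarLinearReachLaw {ϖ : Kˣ} (hϖ : IsUniformizer ϖ) {j : ℕ} {m : ℤ} (h : HStarLinearReachLaw p K ϖ j m)
    {a₀ : ℕ} (hlo : ∀ a < a₀, (p : ℤ) ^ a * ((p : ℤ) - 1) < absRamificationIdx p K)
    (hhi : (absRamificationIdx p K : ℤ) ≤ (p : ℤ) ^ a₀ * ((p : ℤ) - 1)) :
    LinearLaw (absRamificationIdx p K : ℤ) ((absRamificationIdx p K / (p - 1) + 1 : ℕ) : ℤ)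
      ((p : ℤ) ^ a₀ - (absRamificationIdx p K : ℤ) * (a₀ : ℤ)) j m := by
  obtain ⟨c, hc⟩ := exists_isInnerConductor p hϖ
  obtain ⟨B, hB⟩ := exists_isOuterOrder p hϖ
  exact linearLaw_mono_cert (by exact_mod_cast isInnerConductor_le p hϖ hc) (le_of_isOuterOrder p hϖ hB hlo hhi) (h c B hc hB)

/-- **… AND SUFFICIENT OFF THE TIES**: if `(p−1) ∤ e` and the turning point is strict, H⋆'s cell IS the column cell at
`(r_in_ub, r_out_sharp)`. (Note `(p−1) ∤ e` already excludes the cyclotomic indices `p^a·(p−1)`.) [cite: NeukirchANT1999, Ch. II (5.5)] -/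
theorem hStarLinearReachLaw_iff_col {ϖ : Kˣ} (hϖ : IsUniformizer ϖ) (hnd : ¬ (p - 1 ∣ absRamificationIdx p K)) {a₀ : ℕ}
    (hlo : ∀ a < a₀, (p : ℤ) ^ a * ((p : ℤ) - 1) < absRamificationIdx p K)
    (hhi : (absRamificationIdx p K : ℤ) < (p : ℤ) ^ a₀ * ((p : ℤ) - 1)) (j : ℕ) (m : ℤ) :
    HStarLinearReachLaw p K ϖ j m ↔
      LinearLaw (absRamificationIdx p K : ℤ) ((absRamificationIdx p K / (p - 1) + 1 : ℕ) : ℤ)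
        ((p : ℤ) ^ a₀ - (absRamificationIdx p K : ℤ) * (a₀ : ℤ)) j m :=
  hStarLinearReachLaw_iff_of_certs p hϖ (isInnerConductor_of_not_dvd p hϖ hnd) (isOuterOrder_envelope p hϖ hlo hhi) j m

end Lattice

end Summit.ABC.IUTFork.Repair.RH.LinearReachLaw

end
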